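/-
Copyright (c) 2026. All rights reserved.
Released under Apache 2.0 license as described in the file LICENSE.
-/
import Mathlib
import HarnessLib

/-!
# Convert ε-regular count bound for composition

The ε-regular hypothesis gives count ≥ (1-ε)h/s - 1 per side, so total ≥ 2(1-ε)h/s - 2.
To match the (1-ε')·2h/s form, use effective ε' = ε + s/h, so -2 is absorbed.
-/

open Set

noncomputable section

/-- From ε-regular bounds with effective ε' = ε + s/h:
    count_total ≥ 2(1-ε)h/s - 2 = (1-ε')·2h/s. -/
theorem eps_regular_effective_count {s h ε : ℝ} (hs : 0 < s) (hh : 0 < h)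
    (_hε : 0 ≤ ε)
    (count_right count_left : ℕ)
    (hr : |((count_right : ℝ) - h / s)| ≤ ε * h / s + 1)
    (hl : |((count_left : ℝ) - h / s)| ≤ ε * h / s + 1) :
    let ε' := ε + s / h
    ((1 - ε') * 2 * h / s : ℝ) ≤ count_right + count_left := by
  intro ε'
  have hr' := abs_le.mp hr
  have hl' := abs_le.mp hl
  have h1 : (count_right : ℝ) ≥ h / s - ε * h / s - 1 := by linarith [hr'.1]
  have h2 : (count_left : ℝ) ≥ h / s - ε * h / s - 1 := by linarith [hl'.1]
  have h3 : (count_right : ℝ) + count_left ≥ 2 * h / s - 2 * ε * h / s - 2 := by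
    have hadd : (count_right : ℝ) + count_left ≥
        (h / s - ε * h / s - 1) + (h / s - ε * h / s - 1) := by linarith
    calc (count_right : ℝ) + count_left
        ≥ (h / s - ε * h / s - 1) + (h / s - ε * h / s - 1) := hadd
      _ = 2 * h / s - 2 * ε * h / s - 2 := by ring
  have h4 : (1 - ε') * 2 * h / s = (1 - ε) * 2 * h / s - 2 := by
    simp only [ε']
    have hs_ne : s ≠ 0 := ne_of_gt hs
    have hh_ne : h ≠ 0 := ne_of_gt hh
    field_simp; ring
  have h5 : (1 - ε) * 2 * h / s - 2 = 2 * h / s - 2 * ε * h / s - 2 := by ring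
  rw [h4, h5]
  linarith [h3]

/-- With ε' = ε + s/h and 8s ≤ h, ε ≤ 1/8, we have ε' ≤ 1/4. -/
lemma effective_eps_bound {s h ε : ℝ} (_hs : 0 < s) (hh : 0 < h)
    (hsh : 8 * s ≤ h) (hε_small : ε ≤ 1 / 8) :
    ε + s / h ≤ 1 / 4 := by
  have h1 : s / h ≤ 1 / 8 := by
    rw [div_le_div_iff₀ hh (by norm_num : (0 : ℝ) < 8)]
    linarith
  linarith

/-- The coefficient bound 1 - ε' - η ≥ 5/8 when ε' ≤ 1/4, η ≤ 1/8. -/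
lemma coeff_bound_effective {ε' η : ℝ} (hε' : ε' ≤ 1 / 4) (hη : η ≤ 1 / 8) :
    1 - ε' - η ≥ 5 / 8 := by linarith

/-- (5/8)/s ≥ 5/h when 8s ≤ h, and 5/h > 4/h. -/
lemma effective_bound_sufficient {s h : ℝ} (hs : 0 < s) (hh : 0 < h) (hsh : 8 * s ≤ h) :
    (5 / 8) / s > 4 / h := by
  have h1 : 1 / s ≥ 8 / h := by
    rw [ge_iff_le, div_le_div_iff₀ hh hs]
    linarith
  calc (5 / 8) / s = (5 / 8) * (1 / s) := by ring
    _ ≥ (5 / 8) * (8 / h) := by nlinarith [h1]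
    _ = 5 / h := by ring
    _ > 4 / h := by rw [gt_iff_lt, div_lt_div_iff₀ hh hh]; linarith

end
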